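import Summits.Ventures.CertifiedArithmetic.LowPrec.GemmFirstRegimeWindowPhase0
import HarnessLib

/-!
# GEMM worst case LXIX-c — THE WINDOW past the first regime, part 3: the window theorem
# `T·E_n ≤ (d+1)·X⁻_n` in integers

HONEST FRAMING: certified error envelopes and provably optimal rounding/accumulation schemes for
low-precision formats under stated cost models; every table by two implementations; no hardware or
vendor claims.

`windowZ`: for a HIGH word (some argument `≥ 2T`) with `d ≤ 2^m + 3` whose first five
post-prefix arguments stay below `2T`, from an exact prefix ending at an even-or-small `ŝ_{j₀}`
of modulus `≤ 2T`: `T·(ŝ_n - s_n) ≤ (d+1)·(L_n - (ŝ_n - s_n))`, `n = j₀ + 1 + d`; with the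
mirror image, `(T + d + 1)·|ŝ_n - s_n| ≤ (d+1)·L_n` (`windowZ_abs`), i.e. the relative error of
every high word is at most `k/(T+k)`, `k = d + 1`, FOUR STEPS BEYOND the first regime `k ≤ T/2`
of `spineZ` (file LXIV-b).  The proof is the spine bookkeeping of LXIV-b with the multiplier
`k = d+1`: top level `U = 2T·h` and first `U`-step `ib = j₀ + t` (`t ≥ 5`); the signed error
before it is `≤ 5 + (t-5)h` (five level-0 steps, then level-`h` steps); if `h ≥ 2` the five
level-0 steps pay the deficit (`window2_base_pos`), if `h = 1` the phase-0 bound of file LXIX-b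
does (`window1_base_pos`); the negative side and the propagation are those of LXIV-a
(`window_base_neg`, `spine_propagate`).  File LXIX-d turns this into the `relErr` law
`max(k/(B+k), k/(T+k))` for `k ≤ T/2 + 4` and the rows.

References: [Higham2002, §4.2], [IEEE7542019, §4.3.1], [LangeRump2019], [BoldoEtAl2023, Thm 4.5].
-/

namespace Summit.Ventures.CertifiedArithmetic.LowPrec.Gemm

open Literature.ComputerArithmetic.FloatingPoint
open Literature.ComputerArithmetic.FloatingPoint.MiniFloat
open Finset

/-! ### The window theorem in integers -/

/-- THE WINDOW BOUND (integer form).  Letters `z`, accumulators `acc` with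
`acc (i+1) = rneZ m (acc i + z (i+1))`, exact up to `j₀` with `ŝ_{j₀}` even or below `T` and at
most `2T` in modulus, the first five arguments from the entry on below `2T = 2^(m+2)`,
`|δ| ≤ |z|` at every step, `d ≤ 2^m + 3` (`k = d+1 ≤ T/2 + 4`), and SOME argument from the entry
on at or above `2T` (a high word).  Then `T·(ŝ_n - s_n) ≤ (d+1)·(L_n - (ŝ_n - s_n))`,
`n = j₀ + 1 + d`. [cell, gemm.tex Prop. p:fpW] -/
theorem windowZ {m j0 d : ℕ} {z acc : ℕ → ℤ} (hm : 2 ≤ m) (hd : d ≤ 2 ^ m + 3)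
    (hacc : ∀ i, i < j0 + 1 + d → acc (i + 1) = rneZ m (acc i + z (i + 1)))
    (hpre : acc j0 = sZ z j0) (hP0 : (acc j0).natAbs ≤ 2 ^ (m + 2))
    (hP0r : (2 : ℤ) ∣ acc j0 ∨ (acc j0).natAbs < 2 ^ (m + 1))
    (hV5 : ∀ i, j0 ≤ i → i < j0 + 5 → i < j0 + 1 + d →
      (acc i + z (i + 1)).natAbs < 2 ^ (m + 2))
    (hδ : ∀ i, i < j0 + 1 + d →
      (acc (i + 1) - (acc i + z (i + 1))).natAbs ≤ (z (i + 1)).natAbs)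
    (hhigh : ∃ i, j0 ≤ i ∧ i < j0 + 1 + d ∧ 2 ^ (m + 2) ≤ (acc i + z (i + 1)).natAbs) :
    2 ^ (m + 1) * (acc (j0 + 1 + d) - sZ z (j0 + 1 + d))
      ≤ ((d : ℤ) + 1) * (LZ z (j0 + 1 + d) - (acc (j0 + 1 + d) - sZ z (j0 + 1 + d))) := by
  classical
  -- opaque names
  obtain ⟨n, hn⟩ : ∃ n, n = j0 + 1 + d := ⟨_, rfl⟩
  obtain ⟨T, hT⟩ : ∃ T : ℤ, T = 2 ^ (m + 1) := ⟨_, rfl⟩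
  obtain ⟨k, hk⟩ : ∃ k : ℤ, k = (d : ℤ) + 1 := ⟨_, rfl⟩
  obtain ⟨E, hE⟩ : ∃ E : ℕ → ℤ, E = fun j => acc j - sZ z j := ⟨_, rfl⟩
  obtain ⟨X, hX⟩ : ∃ X : ℕ → ℤ, X = fun j => LZ z j - E j := ⟨_, rfl⟩
  have hEj : ∀ j, E j = acc j - sZ z j := fun j => by rw [hE]
  have hXj : ∀ j, X j = LZ z j - E j := fun j => by rw [hX]
  rw [← hn] at hacc hδ hhigh hV5 ⊢
  rw [← hT, ← hk, ← hEj, ← hXj]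
  have hEsucc : ∀ i, E (i + 1) = E i + (acc (i + 1) - (acc i + z (i + 1))) := by
    intro i; rw [hEj, hEj, sZ_succ]; ring
  have hXsucc : ∀ i, X (i + 1)
      = X i + (((z (i + 1)).natAbs : ℤ) - (acc (i + 1) - (acc i + z (i + 1)))) := by
    intro i; rw [hXj, hXj, hEsucc, LZ_succ]; ring
  have hE0 : E j0 = 0 := by rw [hEj, hpre, sub_self]
  have hT8 : (8 : ℤ) ≤ T := by
    rw [hT]
    calc (8 : ℤ) = 2 ^ (2 + 1) := by norm_num
      _ ≤ 2 ^ (m + 1) := pow_le_pow_right₀ (by norm_num) (by omega)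
  have hT0 : (0 : ℤ) ≤ T := by linarith
  have hk8 : 2 * k ≤ T + 8 := by
    have h1 : ((d : ℕ) : ℤ) ≤ ((2 ^ m + 3 : ℕ) : ℤ) := by exact_mod_cast hd
    push_cast at h1
    have h2 : T = 2 * 2 ^ m := by rw [hT]; ring
    rw [hk]; linarith
  have hk1 : (1 : ℤ) ≤ k := by rw [hk]; have := Nat.cast_nonneg (α := ℤ) d; linarith
  -- the top level `e' + 1`
  have hP : ∃ e, ∀ i, j0 ≤ i → i < n → (acc i + z (i + 1)).natAbs < 2 ^ (m + 2 + e) := by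
    refine ⟨∑ i ∈ range n, (acc i + z (i + 1)).natAbs, fun i _ hi => ?_⟩
    have h1 : (acc i + z (i + 1)).natAbs ≤ ∑ i ∈ range n, (acc i + z (i + 1)).natAbs :=
      single_le_sum (f := fun i => (acc i + z (i + 1)).natAbs) (fun _ _ => Nat.zero_le _)
        (mem_range.mpr hi)
    exact lt_of_le_of_lt h1
      (lt_of_lt_of_le Nat.lt_two_pow_self (Nat.pow_le_pow_right (by norm_num) (by omega)))
  have hPz : ¬ ∀ i, j0 ≤ i → i < n → (acc i + z (i + 1)).natAbs < 2 ^ (m + 2 + 0) := by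
    intro h
    obtain ⟨i, hi1, hi2, hi3⟩ := hhigh
    exact absurd (h i hi1 hi2) (not_lt.mpr (by simpa using hi3))
  obtain ⟨e', hPe, hnPe⟩ : ∃ e', (∀ i, j0 ≤ i → i < n →
      (acc i + z (i + 1)).natAbs < 2 ^ (m + 2 + (e' + 1))) ∧
      ¬ ∀ i, j0 ≤ i → i < n → (acc i + z (i + 1)).natAbs < 2 ^ (m + 2 + e') := by
    have hfpos : 0 < Nat.find hP := by
      rw [Nat.pos_iff_ne_zero]; intro h; exact hPz (h ▸ Nat.find_spec hP)
    refine ⟨Nat.find hP - 1, ?_, Nat.find_min hP (by omega)⟩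
    rw [Nat.sub_add_cancel hfpos]; exact Nat.find_spec hP
  -- the first U-step `ib = j₀ + t`, `U = 2^(m+2+e')`
  have hQ : ∃ i, j0 ≤ i ∧ i < n ∧ 2 ^ (m + 2 + e') ≤ (acc i + z (i + 1)).natAbs := by
    by_contra h; exact hnPe fun i h1 h2 => lt_of_not_ge fun h3 => h ⟨i, h1, h2, h3⟩
  obtain ⟨ib, ⟨hib1, hib2, hib3⟩, hlowU⟩ : ∃ ib, (j0 ≤ ib ∧ ib < n ∧
      2 ^ (m + 2 + e') ≤ (acc ib + z (ib + 1)).natAbs) ∧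
      ∀ i, j0 ≤ i → i < ib → (acc i + z (i + 1)).natAbs < 2 ^ (m + 2 + e') :=
    ⟨Nat.find hQ, Nat.find_spec hQ, fun i h1 h2 => by
      by_contra h
      exact Nat.find_min hQ h2 ⟨h1, lt_trans h2 (Nat.find_spec hQ).2.1, not_lt.mp h⟩⟩
  have hpow0 : 2 ^ (m + 2) ≤ 2 ^ (m + 2 + e') := Nat.pow_le_pow_right (by norm_num) (by omega)
  have hib5 : j0 + 5 ≤ ib := by
    by_contra h
    exact absurd (hV5 ib hib1 (by omega) hib2) (not_lt.mpr (le_trans hpow0 hib3))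
  obtain ⟨t, ht5, hibt⟩ : ∃ t, 5 ≤ t ∧ ib = j0 + t := ⟨ib - j0, by omega, by omega⟩
  subst hibt
  have htd : t ≤ d := by omega
  have ht0 : (0 : ℤ) ≤ t := Nat.cast_nonneg t
  have htk : (t : ℤ) + 1 ≤ k := by
    rw [hk]; have : ((t : ℕ) : ℤ) ≤ ((d : ℕ) : ℤ) := by exact_mod_cast htd
    linarith
  -- constants `h = 2^e'`, `U = 2Th = 2^(m+2+e')`
  obtain ⟨Hh, hHh⟩ : ∃ Hh : ℤ, Hh = 2 ^ e' := ⟨_, rfl⟩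
  obtain ⟨U, hU⟩ : ∃ U : ℤ, U = 2 * T * Hh := ⟨_, rfl⟩
  have hHh1 : (1 : ℤ) ≤ Hh := by rw [hHh]; exact one_le_pow₀ (by norm_num)
  have hHhN : ((2 ^ e' : ℕ) : ℤ) = Hh := by rw [hHh]; push_cast; ring
  have hHN : ((2 ^ (e' + 1) : ℕ) : ℤ) = 2 * Hh := by rw [hHh]; push_cast; ring
  have hUN : ((2 ^ (m + 2 + e') : ℕ) : ℤ) = U := by rw [hU, hT, hHh]; push_cast; ring
  obtain ⟨Mh, hMh⟩ : ∃ Mh : ℤ, T = 4 * Mh := by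
    obtain ⟨m', rfl⟩ : ∃ m', m = m' + 1 := ⟨m - 1, by omega⟩
    exact ⟨2 ^ m', by rw [hT]; ring⟩
  have h4H : (2 : ℤ) ^ (e' + 1 + 1) = 4 * Hh := by rw [hHh]; ring
  have h8H : (2 : ℤ) ^ (e' + 1 + 2) = 8 * Hh := by rw [hHh]; ring
  have hU4 : (4 * Hh : ℤ) ∣ U := ⟨2 * Mh, by rw [hU, hMh]; ring⟩
  have hU8 : (8 * Hh : ℤ) ∣ U := ⟨Mh, by rw [hU, hMh]; ring⟩
  -- the signed error before the U-step: five level-0 steps, then level-`e'` steps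
  have hEpre5 : ∀ r, r ≤ 5 → E (j0 + r) ≤ r := by
    intro r
    induction r with
    | zero => intro _; rw [Nat.add_zero, hE0]; norm_num
    | succ r ih =>
        intro hr
        have hlt : (acc (j0 + r) + z (j0 + r + 1)).natAbs < 2 ^ (m + 0 + 2) := by
          simpa using hV5 (j0 + r) (by omega) (by omega) (by omega)
        have h1 := rneZ_err_le (m := m) 0 hlt
        rw [← hacc (j0 + r) (by omega)] at h1
        obtain ⟨h2, -⟩ := le_of_natAbs_le' h1
        rw [show j0 + (r + 1) = j0 + r + 1 by omega, hEsucc]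
        have h3 := ih (by omega)
        push_cast at h2 ⊢
        linarith
  have hEpreH : ∀ r, 5 + r ≤ t → E (j0 + 5 + r) ≤ 5 + (r : ℤ) * Hh := by
    intro r
    induction r with
    | zero => intro _; have := hEpre5 5 le_rfl; push_cast at this ⊢; linarith
    | succ r ih =>
        intro hr
        have hlt : (acc (j0 + 5 + r) + z (j0 + 5 + r + 1)).natAbs < 2 ^ (m + e' + 2) := by
          rw [show m + e' + 2 = m + 2 + e' by omega]
          exact hlowU _ (by omega) (by omega)
        have h1 := rneZ_err_le (m := m) e' hlt
        rw [← hacc (j0 + 5 + r) (by omega)] at h1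
        obtain ⟨h2, -⟩ := le_of_natAbs_le' h1
        rw [hHhN] at h2
        have h3 := ih (by omega)
        rw [show j0 + 5 + (r + 1) = j0 + 5 + r + 1 by omega, hEsucc]
        push_cast
        linarith
  have hEI : E (j0 + t) ≤ Hh * t - 5 * (Hh - 1) := by
    have h1 := hEpreH (t - 5) (by omega)
    rw [show j0 + 5 + (t - 5) = j0 + t by omega] at h1
    have h2 : ((t - 5 : ℕ) : ℤ) = (t : ℤ) - 5 := by
      rw [Nat.cast_sub ht5]; push_cast; ring
    rw [h2] at h1
    linarith
  -- the U-step
  have hKlo : 2 ^ (m + (e' + 1) + 1) ≤ (acc (j0 + t) + z (j0 + t + 1)).natAbs := by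
    rwa [show m + (e' + 1) + 1 = m + 2 + e' by omega]
  have hKhi : (acc (j0 + t) + z (j0 + t + 1)).natAbs < 2 ^ (m + (e' + 1) + 2) := by
    rw [show m + (e' + 1) + 2 = m + 2 + (e' + 1) by omega]; exact hPe _ hib1 hib2
  obtain ⟨hR1, hR2, hR3, hR4, hR5, hR6⟩ := rneZ_level hKlo hKhi
  rw [← hacc (j0 + t) hib2] at hR1 hR2 hR3 hR4 hR5 hR6
  rw [show m + (e' + 1) + 1 = m + 2 + e' by omega] at hR1
  rw [h4H] at hR2
  rw [h8H] at hR4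
  obtain ⟨hδ1, hδ2⟩ := le_of_natAbs_le' hR3
  rw [hHN] at hδ1 hδ2
  have hEb : E (j0 + t + 1) = E (j0 + t)
      + (acc (j0 + t + 1) - (acc (j0 + t) + z (j0 + t + 1))) := hEsucc _
  have hLs := abs_sZ_le_LZ z (j0 + t + 1)
  have hXb : X (j0 + t + 1) = LZ z (j0 + t + 1) - E (j0 + t + 1) := hXj _
  have hEbv : E (j0 + t + 1) = acc (j0 + t + 1) - sZ z (j0 + t + 1) := hEj _
  -- BASE: `T·E_b + (k-1-t)·U ≤ k·X_b` at `b = j₀+t+1`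
  have hbase : T * E (j0 + t + 1) + (k - 1 - t) * U ≤ k * X (j0 + t + 1) := by
    have hKne : acc (j0 + t) + z (j0 + t + 1) ≠ 0 := by
      intro h; rw [h] at hib3; simp at hib3
    rcases lt_or_gt_of_ne hKne with hneg | hpos
    · -- negative side
      have hsb : acc (j0 + t + 1) ≤ -U := by have := hR6 hneg; omega
      refine window_base_neg hU hT0 hHh1 ht0 htk (by linarith) ?_
      rw [hXb, hEbv]
      have := neg_abs_le (sZ z (j0 + t + 1))
      linarith
    · -- positive side: the three cases of the U-step
      have hVU : U ≤ acc (j0 + t) + z (j0 + t + 1) := by omega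
      have hsb : U ≤ acc (j0 + t + 1) := by have := hR5 hpos; omega
      have hcase : (acc (j0 + t + 1) - (acc (j0 + t) + z (j0 + t + 1)) ≤ 0 ∧
            U ≤ acc (j0 + t + 1)) ∨
          (acc (j0 + t + 1) - (acc (j0 + t) + z (j0 + t + 1)) ≤ 2 * Hh - 1 ∧
            U + 4 * Hh ≤ acc (j0 + t + 1)) ∨
          (acc (j0 + t + 1) - (acc (j0 + t) + z (j0 + t + 1)) ≤ 2 * Hh ∧
            U + 8 * Hh ≤ acc (j0 + t + 1)) := by
        by_cases hup : acc (j0 + t + 1) - (acc (j0 + t) + z (j0 + t + 1)) ≤ 0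
        · exact Or.inl ⟨hup, hsb⟩
        · by_cases htie : acc (j0 + t + 1) - (acc (j0 + t) + z (j0 + t + 1)) = 2 * Hh
          · have hdv : (8 * Hh : ℤ) ∣ acc (j0 + t + 1) := hR4 (by omega)
            exact Or.inr (Or.inr ⟨le_of_eq htie,
              add_le_of_dvd_of_lt (by linarith) hdv hU8 (by linarith [lt_of_not_ge hup])⟩)
          · exact Or.inr (Or.inl ⟨by omega,
              add_le_of_dvd_of_lt (by linarith) hR2 hU4 (by linarith [lt_of_not_ge hup])⟩)
      rcases Nat.eq_zero_or_pos e' with he0 | he1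
      · -- top level `2T` (`h = 1`): the phase-0 bound
        subst he0
        have hH1 : Hh = 1 := by rw [hHh]; norm_num
        have hU2 : U = 2 * T := by rw [hU, hH1]; ring
        have hEIt : E (j0 + t) ≤ t := by rw [hH1] at hEI; linarith
        have hAI := abs_sZ_le_LZ z (j0 + t)
        have hAI' := le_abs_self (sZ z (j0 + t))
        -- `Ψ_I ≤ 2T + 2q`
        obtain ⟨q, hq0, hqs, hΨ⟩ : ∃ q : ℤ, q ≤ 0 ∧ q ≤ 2 * k - T ∧
            (T + 2 * k) * E (j0 + t) - 2 * T * t - k * (LZ z (j0 + t) - sZ z (j0 + t))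
              ≤ 2 * T + 2 * q := by
          by_cases hs : T < 2 * k
          · refine ⟨0, le_rfl, by linarith, ?_⟩
            have h1 := phase0_bound (t := t) (k := k) hm (by rw [hT] at hs; exact hs)
              (by rw [hT] at hk8; exact hk8) (fun i h1 h2 => hacc i (by omega)) hpre hP0 hP0r
              (fun i h1 h2 => by simpa using hlowU i h1 h2)
            rw [← hT, ← hEj] at h1
            have h2 : (2 * k - T) * T ≤ 8 * T := mul_le_mul_of_nonneg_right (by linarith) hT0
            linarith
          · refine ⟨2 * k - T, by linarith, le_rfl, ?_⟩
            have h1 := mul_le_mul_of_nonneg_left hEIt (show 0 ≤ T + 2 * k by linarith)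
            have h2 := mul_nonneg (show (0 : ℤ) ≤ k by linarith)
              (show 0 ≤ LZ z (j0 + t) - sZ z (j0 + t) by linarith)
            have h3 : (2 * k - T) * (t : ℤ) ≤ 0 :=
              mul_nonpos_of_nonpos_of_nonneg (by linarith) ht0
            linarith
        rw [hU2]
        refine window1_base_pos (zb := z (j0 + t + 1)) (zab := ((z (j0 + t + 1)).natAbs : ℤ))
          (AI := acc (j0 + t)) (Ab := acc (j0 + t + 1))
          (δ := acc (j0 + t + 1) - (acc (j0 + t) + z (j0 + t + 1)))
          (by linarith) hΨ hq0 hqs (by linarith) (hEj _) (by omega) (by ring) hEb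
          (by rw [hXb, LZ_succ]) ?_
        rw [hU2, hH1] at hcase
        rcases hcase with h | h | h
        · exact Or.inl h
        · exact Or.inr (Or.inl (by constructor <;> linarith [h.1, h.2]))
        · exact Or.inr (Or.inr (by constructor <;> linarith [h.1, h.2]))
      · -- top level `≥ 4T` (`h ≥ 2`): the five level-0 steps pay
        have hHh2 : (2 : ℤ) ≤ Hh := by
          rw [hHh]
          calc (2 : ℤ) = 2 ^ 1 := by norm_num
            _ ≤ 2 ^ e' := pow_le_pow_right₀ (by norm_num) he1
        have hXlow : acc (j0 + t + 1) - 2 * E (j0 + t + 1) ≤ X (j0 + t + 1) := by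
          rw [hXb, hEbv]
          have := le_abs_self (sZ z (j0 + t + 1))
          linarith
        exact window2_base_pos hU (by linarith) hHh2 hk8 ht0 htk hEI hEb hXlow hcase
  -- PROPAGATE from `b` to `n`
  have hbn : j0 + t + 1 ≤ n := by omega
  have hnb : ((n : ℤ) - (j0 + t + 1 : ℕ)) = k - 1 - t := by
    rw [hn, hk]; push_cast; ring
  refine spine_propagate (H := 2 * Hh) (U := U) hbn hT0 (by rw [hU]; ring) (by linarith) ?_ ?_
    (by rw [hnb]; exact hbase)
  · intro j hj1 hj2
    have hlt : (acc j + z (j + 1)).natAbs < 2 ^ (m + (e' + 1) + 2) := by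
      rw [show m + (e' + 1) + 2 = m + 2 + (e' + 1) by omega]; exact hPe _ (by omega) hj2
    have h1 := rneZ_err_le (m := m) (e' + 1) hlt
    rw [← hacc j hj2] at h1
    obtain ⟨h2, -⟩ := le_of_natAbs_le' h1
    rw [hHN] at h2
    rw [hEsucc]; linarith
  · intro j _ hj2
    have h1 := hδ j hj2
    rw [hXsucc]
    have : (acc (j + 1) - (acc j + z (j + 1))) ≤ ((z (j + 1)).natAbs : ℤ) := by
      have := Int.le_natAbs (a := acc (j + 1) - (acc j + z (j + 1))); omega
    linarith

/-- BOTH SIGNS: under the hypotheses of `windowZ` (invariant under `z ↦ -z`),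
`(T + d + 1)·|ŝ_n - s_n| ≤ (d+1)·L_n`. [cell, gemm.tex Prop. p:fpW] -/
theorem windowZ_abs {m j0 d : ℕ} {z acc : ℕ → ℤ} (hm : 2 ≤ m) (hd : d ≤ 2 ^ m + 3)
    (hacc : ∀ i, i < j0 + 1 + d → acc (i + 1) = rneZ m (acc i + z (i + 1)))
    (hpre : acc j0 = sZ z j0) (hP0 : (acc j0).natAbs ≤ 2 ^ (m + 2))
    (hP0r : (2 : ℤ) ∣ acc j0 ∨ (acc j0).natAbs < 2 ^ (m + 1))
    (hV5 : ∀ i, j0 ≤ i → i < j0 + 5 → i < j0 + 1 + d →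
      (acc i + z (i + 1)).natAbs < 2 ^ (m + 2))
    (hδ : ∀ i, i < j0 + 1 + d →
      (acc (i + 1) - (acc i + z (i + 1))).natAbs ≤ (z (i + 1)).natAbs)
    (hhigh : ∃ i, j0 ≤ i ∧ i < j0 + 1 + d ∧ 2 ^ (m + 2) ≤ (acc i + z (i + 1)).natAbs) :
    (2 ^ (m + 1) + (d : ℤ) + 1) * |acc (j0 + 1 + d) - sZ z (j0 + 1 + d)|
      ≤ ((d : ℤ) + 1) * LZ z (j0 + 1 + d) := by
  have h1 := windowZ hm hd hacc hpre hP0 hP0r hV5 hδ hhigh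
  have e1 : ∀ i, -acc i + -z (i + 1) = -(acc i + z (i + 1)) := fun i => by ring
  have e2 : ∀ i, -acc (i + 1) - (-acc i + -z (i + 1)) = -(acc (i + 1) - (acc i + z (i + 1))) :=
    fun i => by ring
  have h2 := windowZ (z := fun i => -z i) (acc := fun i => -acc i) hm hd
    (fun i hi => show -acc (i + 1) = rneZ m (-acc i + -z (i + 1)) by
      rw [e1, rneZ_neg, hacc i hi])
    (show -acc j0 = sZ (fun i => -z i) j0 by rw [sZ_neg, hpre])
    (show (-acc j0).natAbs ≤ 2 ^ (m + 2) by rwa [Int.natAbs_neg])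
    (show (2 : ℤ) ∣ -acc j0 ∨ (-acc j0).natAbs < 2 ^ (m + 1) by
      rw [Int.natAbs_neg, dvd_neg]; exact hP0r)
    (fun i h1 h2 h3 => show (-acc i + -z (i + 1)).natAbs < 2 ^ (m + 2) by
      rw [e1, Int.natAbs_neg]; exact hV5 i h1 h2 h3)
    (fun i hi => show (-acc (i + 1) - (-acc i + -z (i + 1))).natAbs ≤ (-z (i + 1)).natAbs by
      rw [e2, Int.natAbs_neg, Int.natAbs_neg]; exact hδ i hi)
    (by
      obtain ⟨i, h1, h2, h3⟩ := hhigh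
      exact ⟨i, h1, h2, show 2 ^ (m + 2) ≤ (-acc i + -z (i + 1)).natAbs by
        rwa [e1, Int.natAbs_neg]⟩)
  have h2' : 2 ^ (m + 1) * (-acc (j0 + 1 + d) - sZ (fun i => -z i) (j0 + 1 + d)) ≤
      ((d : ℤ) + 1) * (LZ (fun i => -z i) (j0 + 1 + d)
        - (-acc (j0 + 1 + d) - sZ (fun i => -z i) (j0 + 1 + d))) := h2
  rw [sZ_neg, LZ_neg] at h2'
  rcases le_or_gt 0 (acc (j0 + 1 + d) - sZ z (j0 + 1 + d)) with hE | hE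
  · rw [abs_of_nonneg hE]; linarith
  · rw [abs_of_neg hE]; linarith

end Summit.Ventures.CertifiedArithmetic.LowPrec.Gemm
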